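import Summits.CriticalPhenomena.CardyFormulaZ2.Theses.CardyRotToConf
import Literature.Probability.RandomPlanarGeometry.StarShiftOuterContinuity
import HarnessLib

/-!
# Stub `stub_starShiftOuterContinuity` of line `germ-label-transport` (crux `stmt-CriticalPhenomena-0698`)

Brick (b3) of `stub_isLocal` (LSW locality of SLE₆, restriction form; the image driving function
`W̃_t = W_t + L_A − L_{B_t}` of Lawler–Schramm–Werner (2003) §5): continuity of the hydrodynamic
constant `L = starShift` along the dyadic outer hulls of a `*`-hull `B` — for a sequence `b` of
points of `B` dense in `B`, `starShift (outerHull n (outerConfig b n)) → starShift B`. The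
registered stub signature, an instance of the Literature theorem `tendsto_starShift_outerHull`
(`StarShiftOuterContinuity.lean`: `L_H = L_B + L_Q` for the quotient hull `Q` of `B ⊆ H`, which is
thin when `H ⊆ thickHull B δ`, and thin `*`-hulls have small `L`).
-/

noncomputable section

open Literature.Probability.RandomPlanarGeometry

namespace Summit.CriticalPhenomena.CardyFormulaZ2.Theorems.CardyRotToConfR2SymmetryUpgrade

/-- **(b3).** Continuity of `L` along the dyadic outer hulls: for a nonempty `*`-hull `B` and a
sequence `b` of points of `B` dense in `B`,
`starShift (outerHull n (outerConfig b n)) → starShift B` as `n → ∞`.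
[cite: LawlerSchrammWerner2003Restriction, §5] -/
theorem stub_starShiftOuterContinuity : ∀ {B : Set ℂ} {b : ℕ → ℂ}, IsStarHull B → B.Nonempty →
    (∀ k, b k ∈ B) → B ⊆ closure (Set.range b) →
      Filter.Tendsto (fun n ↦ starShift (outerHull n (outerConfig b n))) Filter.atTop
        (nhds (starShift B)) :=
  fun hB hne hb hdense ↦ tendsto_starShift_outerHull hB hne hb hdense

end Summit.CriticalPhenomena.CardyFormulaZ2.Theorems.CardyRotToConfR2SymmetryUpgrade

end
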